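import Summits.CriticalPhenomena.PercolationContinuityZ3.Theorems.PercNearOneGluingNoHeavyLowerTailSahiCTCRtThreeSignedForm
import Summits.CriticalPhenomena.PercolationContinuityZ3.Theorems.PercNearOneGluingNoHeavyLowerTailSahiCTCKleitmanCommonEdges
import HarnessLib

/-!
# `NoHeavyLowerTail` (crux stmt-CriticalPhenomena-4575), P3 lane: the SQUAREFREE ROW of `R_3 ∈ ℕ[s]` BY SLOTS — it holds as soon as the
# common-edge slots balance, in particular for every loop-free pair on at most 7 points (memo g48 §1–§3)

Support file (seat `prim-l12-p3`, gen 48; `--supports stmt-CriticalPhenomena-4575`).  Memo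
`run/shared/lean/prim/prim-l12/FROM-prim-l12-p3-g48-THREE-BLOCK-SLOTS.md` §1–§3.

Start from the signed squarefree row `[s^V] R_3 = Σ_{U ⊆ V, #U ≤ 2} κ(∅, V∖U) + Σ_S (#crossing − #nested small pairs)` (`coeff_ind_Rt_three_eq`).
For a LOOP-FREE pair (no member of size `≤ 1` inside `V`) the nested small pairs are `(R, c)` with `c ⊆ V` a common edge and `R ⊆ V ∖ c` a small
common non-member; book `(R, c)` at the slot `R` when `V ∖ (R ∪ c)` is not a common member and at the slot `c` otherwise.  The slots `R` are paid by
the strengthened Kleitman inequality `card_cubeBadEdges_le_kap` (…SahiCTCKleitmanCommonEdges); the crossing splits of `V ∖ c` with an edge side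
are moved to the slot of that edge, where the same inequality pays them.  Hence:
* **`coeff_ind_Rt_three_nonneg_of_cslots`** : if every common edge `c ⊆ V` satisfies the C-SLOT INEQUALITY
  `#{R ⊆ V∖c small non-member : V∖(R∪c) common member} ≤ κ(∅, V∖c) + #{edges a ⊆ V∖c of one family only whose co-set in V∖c belongs to the
  other family only}`, then `[s^V] R_3(𝒳,𝒵) ≥ 0`;
* **`cslot_of_card_le_five`** : the c-slot inequality holds whenever `#(V∖c) ≤ 5` (every crossing split of `V∖c` then has an edge side);
* **`coeff_ind_Rt_three_nonneg_of_card_le_seven`** : `[s^V] R_3(𝒳,𝒵) ≥ 0` for every loop-free pair of up-sets and every `V` with `#V ≤ 7`.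
Nothing is asserted about the crux.
-/

noncomputable section

open scoped Classical

namespace Summit.CriticalPhenomena.PercolationContinuityZ3.Theorems.SahiCTCForms

open Finset MvPolynomial SahiCTCGenFun

variable {α : Type*} [DecidableEq α] [Fintype α]

/-! ### Disjoint pairs inside `V` -/

omit [Fintype α] in
/-- `Σ_{S ⊆ V} pairsAt A B (V∖S)` is the number of disjoint pairs of `A × B` inside `V`. [this work] -/
theorem sum_pairsAt_eq_card (A B : Finset (Finset α)) (V : Finset α) :
    ∑ S ∈ V.powerset, (pairsAt A B (V \ S) : ℤ) =
      #((A ×ˢ B).filter fun p => Disjoint p.1 p.2 ∧ p.1 ∪ p.2 ⊆ V) := by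
  have hmaps : Set.MapsTo (fun p : Finset α × Finset α => V \ (p.1 ∪ p.2))
      (((A ×ˢ B).filter fun p => Disjoint p.1 p.2 ∧ p.1 ∪ p.2 ⊆ V) : Finset (Finset α × Finset α)) (V.powerset : Finset (Finset α)) :=
    fun p _ => mem_coe.2 (mem_powerset.2 sdiff_subset)
  rw [card_eq_sum_card_fiberwise hmaps]
  push_cast
  refine sum_congr rfl fun S hS => ?_
  have hSV : S ⊆ V := mem_powerset.1 hS
  unfold pairsAt
  congr 2
  ext p
  rw [mem_filter, mem_filter, mem_filter]
  constructor
  · intro h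
    have hu : p.1 ∪ p.2 = V \ S := h.2.2
    refine ⟨⟨h.1, h.2.1, hu ▸ sdiff_subset⟩, ?_⟩
    show V \ (p.1 ∪ p.2) = S
    rw [hu, Finset.sdiff_sdiff_eq_self hSV]
  · intro h
    have hu : p.1 ∪ p.2 ⊆ V := h.1.2.2
    have hS : V \ (p.1 ∪ p.2) = S := h.2
    refine ⟨h.1.1, h.1.2.1, ?_⟩
    rw [← hS, Finset.sdiff_sdiff_eq_self hu]

/-! ### Small members of a loop-free pair -/

section LoopFree
variable {F G : Finset (Finset α)} {V : Finset α}

omit [DecidableEq α] [Fintype α] in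
/-- A member of a family without `∅` and without singletons inside `V`, contained in `V` and of size `≤ 2`, has size exactly `2`. [this work] -/
theorem card_eq_two_of_mem_of_card_le_two (h0 : ∅ ∉ F) (h1 : ∀ v ∈ V, ({v} : Finset α) ∉ F) {c : Finset α} (hc : c ∈ F)
    (hcV : c ⊆ V) (hc2 : #c ≤ 2) : #c = 2 := by
  rcases Nat.lt_or_ge #c 2 with h | h
  · exfalso
    rcases Nat.lt_or_ge #c 1 with h' | h'
    · have hc0 : c = ∅ := card_eq_zero.1 (Nat.lt_one_iff.1 h')
      exact h0 (hc0 ▸ hc)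
    · have hc1 : #c = 1 := le_antisymm (Nat.lt_succ_iff.1 h) h'
      obtain ⟨v, hv⟩ := card_eq_one.1 hc1
      rw [hv] at hc hcV
      exact h1 v (hcV (mem_singleton_self v)) hc
  · exact le_antisymm hc2 h

end LoopFree

/-! ### The squarefree row by slots -/

section Slots
variable {F G : Finset (Finset α)}

/-- **THE SQUAREFREE ROW BY SLOTS.**  For a loop-free pair of up-sets on `V`: if every common edge `c ⊆ V` satisfies the c-slot inequality (the small
common non-members `R ⊆ V∖c` with `V∖(R∪c)` a common member are at most `κ(∅, V∖c)` plus the one-family edges `a ⊆ V∖c` whose co-set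
`V∖(c∪a)` lies in the other family only), then `[s^V] R_3(𝒳,𝒵) ≥ 0`.  The other slots are paid by `card_cubeBadEdges_le_kap`. [this work] -/
theorem coeff_ind_Rt_three_nonneg_of_cslots (hF : IsUpperSet (F : Set (Finset α))) (hG : IsUpperSet (G : Set (Finset α))) (V : Finset α)
    (h0F : ∅ ∉ F) (h1F : ∀ v ∈ V, ({v} : Finset α) ∉ F) (h1G : ∀ v ∈ V, ({v} : Finset α) ∉ G)
    (hc : ∀ c ∈ ((V.powerset.filter fun U => #U ≤ 2).filter fun U => U ∈ F).filter fun U => U ∈ G,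
      (#((V \ c).powerset.filter fun R => #R ≤ 2 ∧ R ∉ F ∧ R ∉ G ∧ (V \ c) \ R ∈ F ∧ (V \ c) \ R ∈ G) : ℤ)
        ≤ kap F G ∅ (V \ c)
          + #((V \ c).powerset.filter fun a => #a = 2 ∧ a ∈ F ∧ a ∉ G ∧ (V \ c) \ a ∈ G ∧ (V \ c) \ a ∉ F)
          + #((V \ c).powerset.filter fun b => #b = 2 ∧ b ∈ G ∧ b ∉ F ∧ (V \ c) \ b ∈ F ∧ (V \ c) \ b ∉ G)) :
    0 ≤ (Rt 3 F G).coeff (ind V) := by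
  -- slots and their four types
  set slots := V.powerset.filter fun U => #U ≤ 2 with hslots
  set Cdom := (slots.filter fun U => U ∈ F).filter fun U => U ∈ G with hCdom
  set Adom := (slots.filter fun U => U ∈ F).filter fun U => ¬ U ∈ G with hAdom
  set Bdom := (slots.filter fun U => ¬ U ∈ F).filter fun U => U ∈ G with hBdom
  set Rdom := (slots.filter fun U => ¬ U ∈ F).filter fun U => ¬ U ∈ G with hRdom
  have hsplit : ∑ U ∈ slots, kap F G ∅ (V \ U) =
      ∑ U ∈ Cdom, kap F G ∅ (V \ U) + ∑ U ∈ Adom, kap F G ∅ (V \ U) +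
        (∑ U ∈ Bdom, kap F G ∅ (V \ U) + ∑ U ∈ Rdom, kap F G ∅ (V \ U)) := by
    rw [← sum_filter_add_sum_filter_not slots (fun U => U ∈ F), ← sum_filter_add_sum_filter_not (slots.filter fun U => U ∈ F) (fun U => U ∈ G),
      ← sum_filter_add_sum_filter_not (slots.filter fun U => ¬ U ∈ F) (fun U => U ∈ G)]
  have hkap0 : ∀ U : Finset α, 0 ≤ kap F G ∅ (V \ U) := fun U => kap_nonneg hF hG _ _ (disjoint_empty_left _)
  -- loop-freeness on the cubes `V \ U`
  have hLX : ∀ (U : Finset α), ∀ u ∈ V \ U, insert u (∅ : Finset α) ∉ F := fun U u hu => by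
    rw [insert_empty]; exact h1F u (mem_sdiff.1 hu).1
  have hLZ : ∀ (U : Finset α), ∀ u ∈ V \ U, insert u (∅ : Finset α) ∉ G := fun U u hu => by
    rw [insert_empty]; exact h1G u (mem_sdiff.1 hu).1
  have hA := fun U : Finset α => card_cubeBadEdges_le_kap hF hG (#(V \ U)) (V \ U) ∅ le_rfl (disjoint_empty_left _) (hLX U) (hLZ U)
  -- the nested small pairs
  set NSP := ((smallN F G) ×ˢ (smallY F G)).filter fun p => Disjoint p.1 p.2 ∧ p.1 ∪ p.2 ⊆ V with hNSP
  have hmemN : ∀ {S : Finset α}, S ∈ smallN F G ↔ #S < 3 ∧ S ∉ F ∧ S ∉ G := fun {S} => by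
    simp only [smallN, bySize, mem_filter, mem_powerset, subset_univ, true_and]
  have hmemY : ∀ {S : Finset α}, S ∈ smallY F G ↔ #S < 3 ∧ S ∈ F ∧ S ∈ G := fun {S} => by
    simp only [smallY, bySize, mem_filter, mem_powerset, subset_univ, true_and]
  have hNSPmem : ∀ {p : Finset α × Finset α}, p ∈ NSP →
      (#p.1 ≤ 2 ∧ p.1 ∉ F ∧ p.1 ∉ G) ∧ (#p.2 = 2 ∧ p.2 ∈ F ∧ p.2 ∈ G) ∧ Disjoint p.1 p.2 ∧ p.1 ⊆ V ∧ p.2 ⊆ V := by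
    intro p hp
    rw [hNSP, mem_filter, mem_product] at hp
    obtain ⟨⟨h1, h2⟩, hd, hu⟩ := hp
    obtain ⟨h1c, h1F', h1G'⟩ := hmemN.1 h1
    obtain ⟨h2c, h2F, h2G⟩ := hmemY.1 h2
    have h2V : p.2 ⊆ V := (subset_union_right).trans hu
    exact ⟨⟨by omega, h1F', h1G'⟩, ⟨card_eq_two_of_mem_of_card_le_two h0F h1F h2F h2V (by omega), h2F, h2G⟩, hd,
      (subset_union_left).trans hu, h2V⟩
  set NSPb := NSP.filter fun p => V \ (p.1 ∪ p.2) ∈ F ∧ V \ (p.1 ∪ p.2) ∈ G with hNSPb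
  set NSPn := NSP.filter fun p => ¬ (V \ (p.1 ∪ p.2) ∈ F ∧ V \ (p.1 ∪ p.2) ∈ G) with hNSPn
  have hNSPsplit : (#NSP : ℤ) = #NSPb + #NSPn := by
    rw [← card_filter_add_card_filter_not (s := NSP) (fun p => V \ (p.1 ∪ p.2) ∈ F ∧ V \ (p.1 ∪ p.2) ∈ G)]; push_cast; rfl
  have hsd : ∀ {R c : Finset α}, Disjoint R c → V \ (R ∪ c) = (V \ c) \ R := fun {R c} _ => by
    ext x; simp only [mem_sdiff, mem_union, not_or]; tauto
  have hsd' : ∀ {R c : Finset α}, Disjoint R c → V \ (R ∪ c) = (V \ R) \ c := fun {R c} _ => by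
    ext x; simp only [mem_sdiff, mem_union, not_or]; tauto
  -- (1) the pairs booked at the r-slots are paid by Lemma A there
  have hNSPn_le : (#NSPn : ℤ) ≤ ∑ R ∈ Rdom, kap F G ∅ (V \ R) := by
    have hmaps : Set.MapsTo (fun p : Finset α × Finset α => p.1) (NSPn : Finset (Finset α × Finset α)) (Rdom : Finset (Finset α)) := by
      intro p hp
      obtain ⟨hpN, -⟩ := mem_filter.1 (mem_coe.1 hp)
      obtain ⟨⟨h1c, h1F', h1G'⟩, -, -, h1V, -⟩ := hNSPmem hpN
      exact mem_coe.2 (by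
        rw [hRdom, mem_filter, mem_filter, hslots, mem_filter, mem_powerset]; exact ⟨⟨⟨h1V, h1c⟩, h1F'⟩, h1G'⟩)
    rw [card_eq_sum_card_fiberwise hmaps]
    push_cast
    refine sum_le_sum fun R hR => le_trans ?_ (hA R)
    have key : #(NSPn.filter fun p => p.1 = R) ≤ #(((V \ R).powerset.filter fun c => #c = 2 ∧ ∅ ∪ c ∈ F ∧ ∅ ∪ c ∈ G).filter
        fun c => ¬ (∅ ∪ ((V \ R) \ c) ∈ F ∧ ∅ ∪ ((V \ R) \ c) ∈ G)) := by
      refine card_le_card_of_injOn (fun p : Finset α × Finset α => p.2) (fun p hp => ?_) (fun p hp p' hp' h => ?_)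
      · obtain ⟨hpn, hpR⟩ := mem_filter.1 (mem_coe.1 hp)
        obtain ⟨hpN, hnb⟩ := mem_filter.1 hpn
        obtain ⟨-, ⟨h2c, h2F, h2G⟩, hd, -, h2V⟩ := hNSPmem hpN
        subst hpR
        refine mem_coe.2 (mem_filter.2 ⟨mem_filter.2 ⟨mem_powerset.2 fun x hx => mem_sdiff.2 ⟨h2V hx, fun h => disjoint_left.1 hd h hx⟩,
          h2c, by rw [empty_union]; exact h2F, by rw [empty_union]; exact h2G⟩, ?_⟩)
        rw [empty_union, ← hsd' hd]; exact hnb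
      · obtain ⟨-, hpR⟩ := mem_filter.1 (mem_coe.1 hp)
        obtain ⟨-, hpR'⟩ := mem_filter.1 (mem_coe.1 hp')
        exact Prod.ext (hpR.trans hpR'.symm) h
    exact_mod_cast key
  -- (2) the pairs booked at the c-slots are bounded by the c-slot hypothesis
  have hNSPb_le : (#NSPb : ℤ) ≤ ∑ c ∈ Cdom, (kap F G ∅ (V \ c)
      + #((V \ c).powerset.filter fun a => #a = 2 ∧ a ∈ F ∧ a ∉ G ∧ (V \ c) \ a ∈ G ∧ (V \ c) \ a ∉ F)
      + #((V \ c).powerset.filter fun b => #b = 2 ∧ b ∈ G ∧ b ∉ F ∧ (V \ c) \ b ∈ F ∧ (V \ c) \ b ∉ G)) := by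
    have hmaps : Set.MapsTo (fun p : Finset α × Finset α => p.2) (NSPb : Finset (Finset α × Finset α)) (Cdom : Finset (Finset α)) := by
      intro p hp
      obtain ⟨hpN, -⟩ := mem_filter.1 (mem_coe.1 hp)
      obtain ⟨-, ⟨h2c, h2F, h2G⟩, -, -, h2V⟩ := hNSPmem hpN
      exact mem_coe.2 (by
        rw [hCdom, mem_filter, mem_filter, hslots, mem_filter, mem_powerset]; exact ⟨⟨⟨h2V, h2c.le⟩, h2F⟩, h2G⟩)
    rw [card_eq_sum_card_fiberwise hmaps]
    push_cast
    refine sum_le_sum fun c hcC => le_trans ?_ (hc c hcC)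
    have key : #(NSPb.filter fun p => p.2 = c) ≤
        #((V \ c).powerset.filter fun R => #R ≤ 2 ∧ R ∉ F ∧ R ∉ G ∧ (V \ c) \ R ∈ F ∧ (V \ c) \ R ∈ G) := by
      refine card_le_card_of_injOn (fun p : Finset α × Finset α => p.1) (fun p hp => ?_) (fun p hp p' hp' h => ?_)
      · obtain ⟨hpb, hpc⟩ := mem_filter.1 (mem_coe.1 hp)
        obtain ⟨hpN, hb⟩ := mem_filter.1 hpb
        obtain ⟨⟨h1c, h1F', h1G'⟩, -, hd, h1V, -⟩ := hNSPmem hpN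
        subst hpc
        refine mem_coe.2 (mem_filter.2 ⟨mem_powerset.2 fun x hx => mem_sdiff.2 ⟨h1V hx, fun h => disjoint_left.1 hd hx h⟩,
          h1c, h1F', h1G', ?_⟩)
        rw [← hsd hd]; exact hb
      · obtain ⟨-, hpc⟩ := mem_filter.1 (mem_coe.1 hp)
        obtain ⟨-, hpc'⟩ := mem_filter.1 (mem_coe.1 hp')
        exact Prod.ext h (hpc.trans hpc'.symm)
    exact_mod_cast key
  -- (3) the moved edge-sided crossings are paid at the a-/b-slots by Lemma A there
  have hext : ∀ (P : Finset α → Prop) (Q : Finset α → Prop) (Edom : Finset (Finset α)),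
      (∀ a, a ∈ Edom ↔ a ∈ slots ∧ P a) → (∀ a, P a → a ∈ F ∨ a ∈ G) →
      (∀ S, Q S → ¬ (S ∈ F ∧ S ∈ G)) →
      ∑ c ∈ Cdom, (#((V \ c).powerset.filter fun a => #a = 2 ∧ P a ∧ Q ((V \ c) \ a)) : ℤ) ≤ ∑ a ∈ Edom, kap F G ∅ (V \ a) := by
    intro P Q Edom hE hPmem hQ
    -- the set of pairs (c, a)
    set PR := (Cdom ×ˢ Edom).filter fun p => Disjoint p.1 p.2 ∧ Q (V \ (p.1 ∪ p.2)) with hPR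
    have h1 : ∑ c ∈ Cdom, (#((V \ c).powerset.filter fun a => #a = 2 ∧ P a ∧ Q ((V \ c) \ a)) : ℤ) ≤ #PR := by
      have hmaps : Set.MapsTo (fun p : Finset α × Finset α => p.1) (PR : Finset (Finset α × Finset α)) (Cdom : Finset (Finset α)) :=
        fun p hp => mem_coe.2 (mem_product.1 (mem_filter.1 (mem_coe.1 hp)).1).1
      rw [card_eq_sum_card_fiberwise hmaps]
      push_cast
      refine sum_le_sum fun c hcC => ?_
      have key : #((V \ c).powerset.filter fun a => #a = 2 ∧ P a ∧ Q ((V \ c) \ a)) ≤ #(PR.filter fun p => p.1 = c) := by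
        refine card_le_card_of_injOn (fun a : Finset α => (c, a)) (fun a ha => ?_) (fun a _ a' _ h => (Prod.ext_iff.1 h).2)
        obtain ⟨haV, ha2, hPa, hQa⟩ := mem_filter.1 (mem_coe.1 ha)
        have haV' := mem_powerset.1 haV
        have hd : Disjoint c a := disjoint_left.2 fun x hxc hxa => (mem_sdiff.1 (haV' hxa)).2 hxc
        refine mem_coe.2 (mem_filter.2 ⟨mem_filter.2 ⟨mem_product.2 ⟨hcC, (hE a).2 ⟨?_, hPa⟩⟩, hd, ?_⟩, rfl⟩)
        · rw [hslots, mem_filter, mem_powerset]; exact ⟨fun x hx => (mem_sdiff.1 (haV' hx)).1, le_of_eq ha2⟩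
        · rw [hsd' hd]; exact hQa
      exact_mod_cast key
    have h2 : (#PR : ℤ) ≤ ∑ a ∈ Edom, kap F G ∅ (V \ a) := by
      have hmaps : Set.MapsTo (fun p : Finset α × Finset α => p.2) (PR : Finset (Finset α × Finset α)) (Edom : Finset (Finset α)) :=
        fun p hp => mem_coe.2 (mem_product.1 (mem_filter.1 (mem_coe.1 hp)).1).2
      rw [card_eq_sum_card_fiberwise hmaps]
      push_cast
      refine sum_le_sum fun a haE => le_trans ?_ (hA a)
      have key : #(PR.filter fun p => p.2 = a) ≤ #(((V \ a).powerset.filter fun c => #c = 2 ∧ ∅ ∪ c ∈ F ∧ ∅ ∪ c ∈ G).filter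
          fun c => ¬ (∅ ∪ ((V \ a) \ c) ∈ F ∧ ∅ ∪ ((V \ a) \ c) ∈ G)) := by
       refine card_le_card_of_injOn (fun p : Finset α × Finset α => p.1) (fun p hp => ?_) (fun p hp p' hp' h => ?_)
       · obtain ⟨hpPR, hpa⟩ := mem_filter.1 (mem_coe.1 hp)
         obtain ⟨hcd, hd, hQp⟩ := mem_filter.1 hpPR
         obtain ⟨hcC, -⟩ := mem_product.1 hcd
         subst hpa
         obtain ⟨⟨hcs, hcF⟩, hcG⟩ : (p.1 ∈ slots ∧ p.1 ∈ F) ∧ p.1 ∈ G := by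
           rw [hCdom, mem_filter, mem_filter] at hcC; exact hcC
         obtain ⟨hcV, hc2⟩ := mem_filter.1 hcs
         have hcV' := mem_powerset.1 hcV
         refine mem_coe.2 (mem_filter.2 ⟨mem_filter.2 ⟨mem_powerset.2 fun x hx => mem_sdiff.2 ⟨hcV' hx, fun h => disjoint_left.1 hd hx h⟩,
           card_eq_two_of_mem_of_card_le_two h0F h1F hcF hcV' hc2, by rw [empty_union]; exact hcF, by rw [empty_union]; exact hcG⟩, ?_⟩)
         rw [empty_union, ← hsd hd]; exact hQ _ hQp
       · obtain ⟨-, hpa⟩ := mem_filter.1 (mem_coe.1 hp)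
         obtain ⟨-, hpa'⟩ := mem_filter.1 (mem_coe.1 hp')
         exact Prod.ext h (hpa.trans hpa'.symm)
      exact_mod_cast key
    exact h1.trans h2
  have hext1 : ∑ c ∈ Cdom, (#((V \ c).powerset.filter fun a => #a = 2 ∧ a ∈ F ∧ a ∉ G ∧ (V \ c) \ a ∈ G ∧ (V \ c) \ a ∉ F) : ℤ)
      ≤ ∑ a ∈ Adom, kap F G ∅ (V \ a) := by
    have h := hext (fun a => a ∈ F ∧ a ∉ G) (fun S => S ∈ G ∧ S ∉ F) Adom
      (fun a => by rw [hAdom, mem_filter, mem_filter, and_assoc]) (fun a h => Or.inl h.1) (fun S h h' => h.2 h'.1)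
    simpa only [and_assoc] using h
  have hext2 : ∑ c ∈ Cdom, (#((V \ c).powerset.filter fun b => #b = 2 ∧ b ∈ G ∧ b ∉ F ∧ (V \ c) \ b ∈ F ∧ (V \ c) \ b ∉ G) : ℤ)
      ≤ ∑ b ∈ Bdom, kap F G ∅ (V \ b) := by
    have h := hext (fun b => b ∈ G ∧ b ∉ F) (fun S => S ∈ F ∧ S ∉ G) Bdom
      (fun b => by rw [hBdom, mem_filter, mem_filter, and_assoc]; tauto) (fun b h => Or.inr h.1) (fun S h h' => h.2 h'.2)
    simpa only [and_assoc] using h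
  -- assemble
  refine coeff_ind_Rt_three_nonneg_of_le F G V ?_
  have hcross : (0 : ℤ) ≤ ∑ S ∈ V.powerset, (pairsAt (smallXo F G) (smallZo F G) (V \ S) : ℤ) :=
    sum_nonneg fun S _ => Nat.cast_nonneg _
  have hnsp : ∑ S ∈ V.powerset, (pairsAt (smallN F G) (smallY F G) (V \ S) : ℤ) = #NSP := sum_pairsAt_eq_card _ _ V
  rw [hnsp, hNSPsplit, hsplit]
  rw [sum_add_distrib, sum_add_distrib] at hNSPb_le
  linarith [hNSPn_le, hNSPb_le, hext1, hext2, hcross]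

omit [Fintype α] in
/-- **The c-slot inequality on small co-sets**: if `#(V∖c) ≤ 5` then every crossing split of `V∖c` has a side of size `2`, i.e. an edge of one
family only, so `#reserved ≤ κ(∅, V∖c) + #(edge-sided crossings)` by the pair formula `kap_eq_pairs`. [this work] -/
theorem cslot_of_card_le_five (V c : Finset α) (h0F : ∅ ∉ F) (h0G : ∅ ∉ G)
    (h1F : ∀ v ∈ V, ({v} : Finset α) ∉ F) (h1G : ∀ v ∈ V, ({v} : Finset α) ∉ G) (h5 : #(V \ c) ≤ 5) :
    (#((V \ c).powerset.filter fun R => #R ≤ 2 ∧ R ∉ F ∧ R ∉ G ∧ (V \ c) \ R ∈ F ∧ (V \ c) \ R ∈ G) : ℤ)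
      ≤ kap F G ∅ (V \ c)
        + #((V \ c).powerset.filter fun a => #a = 2 ∧ a ∈ F ∧ a ∉ G ∧ (V \ c) \ a ∈ G ∧ (V \ c) \ a ∉ F)
        + #((V \ c).powerset.filter fun b => #b = 2 ∧ b ∈ G ∧ b ∉ F ∧ (V \ c) \ b ∈ F ∧ (V \ c) \ b ∉ G) := by
  set s := V \ c with hs
  have hsV : s ⊆ V := sdiff_subset
  rw [kap_eq_pairs]
  -- reserved sets inject into the positive pairs via `R ↦ s \ R`
  have hres : #(s.powerset.filter fun R => #R ≤ 2 ∧ R ∉ F ∧ R ∉ G ∧ s \ R ∈ F ∧ s \ R ∈ G)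
      ≤ #((tr F ∅ s ∩ tr G ∅ s).filter fun U => s \ U ∉ tr F ∅ s ∧ s \ U ∉ tr G ∅ s) := by
    refine card_le_card_of_injOn (fun R => s \ R) (fun R hR => ?_) (fun R hR R' hR' h => ?_)
    · obtain ⟨hRs, -, hRF, hRG, hF', hG'⟩ := mem_filter.1 (mem_coe.1 hR)
      have hRs' := mem_powerset.1 hRs
      refine mem_coe.2 (mem_filter.2 ⟨mem_inter.2 ⟨mem_tr_empty.2 ⟨sdiff_subset, hF'⟩, mem_tr_empty.2 ⟨sdiff_subset, hG'⟩⟩, ?_, ?_⟩) <;>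
        rw [Finset.sdiff_sdiff_eq_self hRs', mem_tr_empty]
      · exact fun h => hRF h.2
      · exact fun h => hRG h.2
    · have h1 := mem_powerset.1 (mem_filter.1 (mem_coe.1 hR)).1
      have h2 := mem_powerset.1 (mem_filter.1 (mem_coe.1 hR')).1
      have h' : s \ R = s \ R' := h
      rw [← Finset.sdiff_sdiff_eq_self h1, h', Finset.sdiff_sdiff_eq_self h2]
  -- negative pairs have an edge side
  set NEG := (tr F ∅ s \ tr G ∅ s).filter fun U => s \ U ∈ tr G ∅ s ∧ s \ U ∉ tr F ∅ s with hNEG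
  have hNEGmem : ∀ {U : Finset α}, U ∈ NEG → U ⊆ s ∧ U ∈ F ∧ U ∉ G ∧ s \ U ∈ G ∧ s \ U ∉ F := by
    intro U hU
    obtain ⟨hU1, hU2, hU3⟩ := mem_filter.1 hU
    obtain ⟨hUF, hUG⟩ := mem_sdiff.1 hU1
    obtain ⟨hUs, hUF'⟩ := mem_tr_empty.1 hUF
    exact ⟨hUs, hUF', fun h => hUG (mem_tr_empty.2 ⟨hUs, h⟩), (mem_tr_empty.1 hU2).2, fun h => hU3 (mem_tr_empty.2 ⟨sdiff_subset, h⟩)⟩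
  have h1s : ∀ v ∈ s, ({v} : Finset α) ∉ F := fun v hv => h1F v (hsV hv)
  have h1s' : ∀ v ∈ s, ({v} : Finset α) ∉ G := fun v hv => h1G v (hsV hv)
  have hsmall : #(NEG.filter fun U => #U ≤ 2) ≤ #(s.powerset.filter fun a => #a = 2 ∧ a ∈ F ∧ a ∉ G ∧ s \ a ∈ G ∧ s \ a ∉ F) := by
    refine card_le_card fun U hU => ?_
    obtain ⟨hUN, hU2⟩ := mem_filter.1 hU
    obtain ⟨hUs, hUF, hUG, hG', hF'⟩ := hNEGmem hUN
    exact mem_filter.2 ⟨mem_powerset.2 hUs, card_eq_two_of_mem_of_card_le_two h0F h1s hUF hUs hU2, hUF, hUG, hG', hF'⟩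
  have hbig : #(NEG.filter fun U => ¬ #U ≤ 2) ≤ #(s.powerset.filter fun b => #b = 2 ∧ b ∈ G ∧ b ∉ F ∧ s \ b ∈ F ∧ s \ b ∉ G) := by
    refine card_le_card_of_injOn (fun U => s \ U) (fun U hU => ?_) (fun U hU U' hU' h => ?_)
    · obtain ⟨hUN, hU2⟩ := mem_filter.1 (mem_coe.1 hU)
      obtain ⟨hUs, hUF, hUG, hG', hF'⟩ := hNEGmem hUN
      have hcard : #(s \ U) ≤ 2 := by
        have := card_sdiff_add_card_eq_card hUs; omega
      refine mem_coe.2 (mem_filter.2 ⟨mem_powerset.2 sdiff_subset, card_eq_two_of_mem_of_card_le_two h0G h1s' hG' sdiff_subset hcard,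
        hG', hF', ?_, ?_⟩) <;> rw [Finset.sdiff_sdiff_eq_self hUs]
      · exact hUF
      · exact hUG
    · have h1 := (hNEGmem (mem_filter.1 (mem_coe.1 hU)).1).1
      have h2 := (hNEGmem (mem_filter.1 (mem_coe.1 hU')).1).1
      have h' : s \ U = s \ U' := h
      rw [← Finset.sdiff_sdiff_eq_self h1, h', Finset.sdiff_sdiff_eq_self h2]
  have hNEGsplit := card_filter_add_card_filter_not (s := NEG) (fun U => #U ≤ 2)
  have e1 : (#NEG : ℤ) ≤ #(s.powerset.filter fun a => #a = 2 ∧ a ∈ F ∧ a ∉ G ∧ s \ a ∈ G ∧ s \ a ∉ F)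
      + #(s.powerset.filter fun b => #b = 2 ∧ b ∈ G ∧ b ∉ F ∧ s \ b ∈ F ∧ s \ b ∉ G) := by
    have : #NEG ≤ _ + _ := hNEGsplit ▸ Nat.add_le_add hsmall hbig
    exact_mod_cast this
  have e2 : (#(s.powerset.filter fun R => #R ≤ 2 ∧ R ∉ F ∧ R ∉ G ∧ s \ R ∈ F ∧ s \ R ∈ G) : ℤ)
      ≤ #((tr F ∅ s ∩ tr G ∅ s).filter fun U => s \ U ∉ tr F ∅ s ∧ s \ U ∉ tr G ∅ s) := by exact_mod_cast hres
  linarith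

/-- **ROW 0 OF `R_3 ∈ ℕ[s]` ON AT MOST SEVEN POINTS**: for every loop-free pair of up-sets (no member of size `≤ 1` meeting `V`... precisely: `∅` and
the singletons of `V` are non-members) and every finset `V` with `#V ≤ 7`, the squarefree coefficient `[s^V] R_3(𝒳,𝒵)` is nonnegative. [this work] -/
theorem coeff_ind_Rt_three_nonneg_of_card_le_seven (hF : IsUpperSet (F : Set (Finset α))) (hG : IsUpperSet (G : Set (Finset α)))
    (V : Finset α) (hV : #V ≤ 7) (h0F : ∅ ∉ F) (h0G : ∅ ∉ G) (h1F : ∀ v ∈ V, ({v} : Finset α) ∉ F)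
    (h1G : ∀ v ∈ V, ({v} : Finset α) ∉ G) : 0 ≤ (Rt 3 F G).coeff (ind V) := by
  refine coeff_ind_Rt_three_nonneg_of_cslots hF hG V h0F h1F h1G fun c hc => ?_
  obtain ⟨hc1, hcG⟩ := mem_filter.1 hc
  obtain ⟨hc2, hcF⟩ := mem_filter.1 hc1
  obtain ⟨hcV, hc3⟩ := mem_filter.1 hc2
  have hcV' := mem_powerset.1 hcV
  have hc2' : #c = 2 := card_eq_two_of_mem_of_card_le_two h0F h1F hcF hcV' hc3
  have h5 : #(V \ c) ≤ 5 := by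
    have := card_sdiff_add_card_eq_card hcV'; omega
  exact cslot_of_card_le_five V c h0F h0G h1F h1G h5

end Slots

end Summit.CriticalPhenomena.PercolationContinuityZ3.Theorems.SahiCTCForms
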